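import Summits.BirchSwinnertonDyer.Rank1Residual.X11b.AtomA1SelmerCertificate
import Summits.BirchSwinnertonDyer.Rank1Residual.X10.JetchevTamagawaCertificate
import HarnessLib

/-!
# X11b at `p = 3`, the Tamagawa atom (T2′) (`(ram) ∧ 3 ∣ ∏c_ℓ`), `#Ш_an = 9` rows: `BSD(E,3)` from
# Miller 2011 Thm. 5.4 (Jetchev's Tamagawa-sharpened index bound in CHA's case — `p² ∤ N`, so
# `3 ∥ N` IS ALLOWED) + ONE exact `3`-descent certificate — per pair (cell `b2b-bsdres`, team
# `x11b3` = N8/O2, seat p5, PLAN v1 sub-target S5 · LB3NOUPPER / JET3N)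

HONEST FRAMING (cell `b2b-bsdres`, run/shared/lean/b2b/bsd-rank1-residual/, verbatim in every
file): the goal of the cell is to DELETE the COMBINATION-SHAPED residual classes of the
Birch–Swinnerton-Dyer formula for ALL analytic-rank `≤ 1` elliptic curves over `ℚ` — "full BSD
formula for every rank `≤ 1` curve in class `C`" assembled STRICTLY from published theorems — so
that the rank-`≤ 1` remainder becomes exactly the CONSTRUCTION-SHAPED classes, which are TYPED
(missing-input `Prop`s), NOT attempted. This is not "finishing BSD". Team `x11b3` is a RESEARCH
team; no claim beyond the stated class and atom; X11b and X11 ∧ `r = 1` ∧ `p = 3` stay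
CONSTRUCTION-SHAPED (REFEREE R6.2); §I O2 stays OPEN; nothing here is booked (the lane books; every
pair closed through this file carries the flag `Miller11-Thm54-Cha-case` of the named fact it
consumes); census numbers below are EVIDENCE pointers, never inputs. THEOREMS ONLY (no definition,
no named fact, no `sorry`).

## What this file does (and why no TYPED "Jetchev at `3 ∣ N`" input is needed)

PLAN v1 §2 S5 asks, for the five (T2′) classes among the seven "`#Ш_an = 9`, `#Sel₃ = 27` EXACT, no
upper half" classes of rmap-3 g5 / x11b gen 9 (`191424ce1, 318828a1, 368358k1, 463488bg1,
498525ca1`; the two A1 classes are `X11b/AtomA1SelmerCertificate.lean`), a closer 'LB3 + a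
Jetchev-type Tamagawa-sharpened index bound at `3 ∣ N`' with the bound a TYPED input, because
Jetchev, Compos. Math. 144 (2008), prints Cor. 1.5 under Hypothesis (∗) "`p ∤ 2N` and … `ρ_{E,p}`
surjective" (harvest-2 GEN 29). THE TREE ALREADY HOLDS A PUBLISHED STATEMENT OF THAT BOUND WHOSE
PRINTED HYPOTHESES ALLOW `p ∥ N`: Miller, LMS J. Comput. Math. 14 (2011) **Thm. 5.4** "(Jetchev). If
the hypotheses of any of Theorems 5.1, 5.2 or 5.3 apply to `p`, then
`ord_p(#Ш(ℚ,E)) ≤ 2·(ord_p(I_K) − max_{q∣N} ord_p(c_q))`" read with **Thm. 5.2 (Cha)**'s hypotheses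
"`r_an(E/ℚ) ≤ 1` and `p` is a prime such that `p ∤ 2·Δ(K)`, `p² ∤ N` and `ρ̄_{E,p}` is irreducible"
[corpus: `paper:arxiv-1010.2431` p0011 L24–L31, L42–L50] — vendored by unit x9 gen 7 as the named fact
`Miller2011.thm54_cha_padicValNat_shaOrder_add_tamagawa_le` (`Literature/…/Miller2011/JetchevBoundIrreducible.lean`,
FLAG `Miller11-Thm54-Cha-case`: the printed proof is the citation of Jetchev 2008; referee R83.3 /
R2-20.1: bookable PUB with the mandatory flag), and consumed class-free by unit x10's
`X10.missingUpperBoundAt_of_millerJetchev_of_index_le` (`X10/JetchevTamagawaCertificate.lean`, any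
odd `p`, any analytic rank `≤ 1`). At `3 ∥ N` Cha's side conditions HOLD on X11b: `9 ∤ N` (conductor
exponent `1` at a multiplicative prime — `not_sq_dvd_level_of_isHeegnerPoint`, granted Carayol's
`N = N_E` for the level of the Heegner datum), `3 ∤ d_K` (the Heegner field of record; `3 ∣ N` splits
in `K`), `E[3]` irreducible (class), non-CM (a CM curve has no multiplicative prime,
`not_mult_of_hasCM`). So the (T2′) rows need NO new input: this file composes

* UPPER: `X10.missingUpperBoundAt_of_millerJetchev_of_index_le` — `ord_p #Ш(E/ℚ) ≤ 2k` from the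
  Tamagawa-INFLATED index certificate `ord_p [E(K) : ℤ y_K] ≤ k + ord_p c_q(E)` at ONE prime `q ∣ N`
  [Miller Thm. 5.4, Cha case; FLAG];
* LOWER: the exact `p`-descent count `#Sel^(p)(E/ℚ) = p^(1+2k)` ⇒ `p^{2k} ∣ #Ш(E/ℚ)`
  (`pow_dvd_shaOrder_of_card_selmerGroup`, x11b gen 9; `E(ℚ)[p] = 0` by irreducibility) — NO
  Cassels–Tate (x10's `bsdp_of_millerJetchev_of_casselsTate_of_dvd` uses `p^{2k−1} ∣ #Ш` + squareness
  instead);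
* `ord_p #Ш(E)_an = 2k` ⇒ `BSD(E,p)` (`bsdp_of_halves`).

Theorems: `bsdp_of_millerJetchev_of_card_selmer` (class-free, rank one, any odd `p`, Cha's binders
verbatim), `bsdp_of_mult_of_millerJetchev_of_card_selmer` (at a MULTIPLICATIVE `p`: non-CM and
`p² ∤ N` DISCHARGED, Carayol granted), and the `p = 3` rows
`IsX11Three.bsdp_of_millerJetchev_of_card_selmerThree_eq` / `….ClassX11b.bsdp_three_…` in the shape of
the five classes: `#Sel₃ = 27`, `ord₃ #Ш_an = 2`, `ord₃ [E(K):ℤ y_K] ≤ 2` at the Heegner field of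
record, ONE prime `q ∣ N` with `3 ∣ c_q(E)`. EVIDENCE pointer (lane data; nothing booked here): on the
five, `ord₃ [E(K):ℤ y_K] = 2` at every field of record is FORCED (Gross–Zagier bookkeeping:
`2·ord₃ I_K = ord₃ #Ш_an(E) + ord₃ #Ш_an(E^{d_K}) + 2·ord₃ ∏c_ℓ ≥ 4`), and Kolyvagin's unsharpened bound
gives only `ord₃ #Ш(E) ≤ 4` there (`IsX11Three.padicValNat_shaOrder_le_add_of_ram`); the sharpening by
`2·ord₃ c_q = 2` is exactly what closes them. With the sibling A1 file, ALL SEVEN "no-upper-half"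
classes have a kernel consumer fed by PUBLISHED facts and certificates the lane already holds
(LB3, index at the field of record, Cremona's `c_q`, exact `#Ш_an`). Per pair; NOT a class theorem;
the (T2′)@3 CLASS input (route p2's `hU` off the atom A1) is untouched.

References: [Miller2011LMS] Thm. 5.2, Thm. 5.4, Def. 1.1 (arXiv:1010.2431 p. 11); [Jetchev2008]
Hypothesis (∗), Cor. 1.5 (p. 812 printed / p. 3 arXiv), Rem. 6.2; [Cha2005];
[GrigorovJorzaPatrikisSteinTarnita2009] §3.1 Thm. 3.5, Rem. 3.13; [Carayol1986] Thm. (A);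
[SilvermanAEC2009] X.4.2; [SilvermanATAEC1994] II.6.4, IV.10.2; [Mazur1977] III.§5; cell files
`X10/JetchevTamagawaCertificate.lean`, `X11b/AtomA1SelmerCertificate.lean`, `X11b/SelmerRankOne.lean`,
`X11b/ChaRoute.lean`; harvest-2 GEN 29 (E66) for the printed locators of Jetchev 2008.
-/

noncomputable section

open scoped Classical

open WeierstrassCurve NumberField Literature.NumberTheory.EllipticCurves
  Literature.NumberTheory.EllipticCurves.ModularForms
  Literature.NumberTheory.EllipticCurves.Rank1Residual
  Literature.NumberTheory.EllipticCurves.Rank1Residual.Typed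
  Literature.NumberTheory.EllipticCurves.Miller2011

namespace Summit.BirchSwinnertonDyer.Rank1Residual.X11b.Three

/-! ### §1. Class-free, rank one, any odd `p`: Miller Thm. 5.4 (Cha case) + exact `p`-descent -/

section ClassFree

variable (W : WeierstrassCurve ℚ) [W.IsElliptic] [W.IsGloballyMinimal] (p : ℕ) [Fact p.Prime]

/-- **Rank one, odd `p`, Cha's side conditions (`p ∤ d_K`, `p² ∤ N`, `E[p]` irreducible, non-CM —
`p ∥ N` ALLOWED): `BSD(E,p)` from PUBLISHED theorems plus per-pair certificates — the
Tamagawa-inflated Heegner-index certificate `ord_p [E(K) : ℤ y_K] ≤ k + ord_p c_q(E)` at ONE prime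
`q ∣ N` (UPPER half, Miller 2011 Thm. 5.4 in Cha's case = Jetchev's sharpening, named fact `hMJ`,
FLAG `Miller11-Thm54-Cha-case`) and the exact `p`-descent count `#Sel^(p)(E/ℚ) = p^(1+2k)` (LOWER
half: `Ш(E/ℚ)[p] ≅ (ℤ/p)^{2k}`, so `p^{2k} ∣ #Ш(E/ℚ)`; `E(ℚ)[p] = 0` by irreducibility, Mazur), with
`ord_p #Ш(E)_an = 2k`.** GZK (`hGZK`, bsd.S17) supplies `rank E(ℚ) = r_an = 1` and the finiteness of
`Ш(E/ℚ)`. NO Cassels–Tate, NO partner curve, NO surjectivity. Per pair; not a class theorem.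
[cite: Miller2011LMS, Thm. 5.4 and Thm. 5.2 (arXiv:1010.2431 p. 11 L24–L31, L42–L50), Def. 1.1]
[cite: Jetchev2008, Cor. 1.5 and Rem. 6.2] [cite: SilvermanAEC2009, Thm. X.4.2(a)]
[cite: Mazur1977, Ch. III §5, p. 157] -/
theorem bsdp_of_millerJetchev_of_card_selmer
    (hGZK : rank_eq_analyticRank_of_analyticRank_le_one)
    (hMJ : thm54_cha_padicValNat_shaOrder_add_tamagawa_le)
    (hcm : ¬ W.HasCM) (hr : W.analyticRank = 1) (hp2 : p ≠ 2) (hirr : Irr W p)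
    {N : ℕ} [NeZero N] {K : Type} [Field K] [NumberField K] (hK : IsImaginaryQuadratic K)
    (hH : SatisfiesHeegnerHypothesis N K) {P : (W.baseChange K).toAffine.Point}
    (hP : IsHeegnerPoint N W K P) (hnt : ¬ IsOfFinAddOrder P)
    (hpD : ¬ (p : ℤ) ∣ NumberField.discr K) (hpN : ¬ p ^ 2 ∣ N)
    -- the certificates: ONE prime `q ∣ N` with the Tamagawa-inflated index bound, the Selmer count,
    -- and `#Ш_an`
    (q : ℕ) [Fact q.Prime] (hqN : q ∣ N) {k : ℕ}
    (hI : padicValNat p (AddSubgroup.zmultiples P).index ≤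
      k + padicValNat p ((W.baseChange ℚ_[q]).localTamagawaNumber ℤ_[q]))
    (hcard : Nat.card (W.selmerGroup (p : ℤ)) = p ^ (1 + 2 * k))
    {s : ℚ} (hs : shaAn W = (s : ℂ)) (hv : padicValRat p s = 2 * k) : BSDp W p := by
  obtain ⟨hrk, hfin⟩ := hGZK W (le_of_eq hr)
  -- LOWER certificate `p^(2k) ∣ #Ш(E/ℚ)` from the Selmer count (no rational `p`-torsion: Mazur)
  have hdvd : p ^ (2 * k) ∣ W.shaOrder :=
    pow_dvd_shaOrder_of_card_selmerGroup W p (j := 2 * k) (by rw [hrk, hr]; exact hcard)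
      ((natCard_torsionBy_point_eq_of_subsingleton W _ _ _).trans
        (natCard_torsionBy_eq_one_of_hasIrreducibleModPGaloisRep W p hirr))
  have hlow : MissingLowerBoundAt W p :=
    missingLowerBoundAt_of_pow_dvd W p hfin hs (j := 2 * k) (by rw [hv]; push_cast; exact le_rfl) hdvd
  -- UPPER half: Miller Thm. 5.4 (Cha case) with the Tamagawa-inflated index certificate at `q`
  have hup : MissingUpperBoundAt W p :=
    X10.missingUpperBoundAt_of_millerJetchev_of_index_le W p hMJ hcm (le_of_eq hr) hK hH hP hnt hp2
      hpD hpN hirr q hqN hI hs (by rw [hv])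
  exact bsdp_of_halves hGZK W p (le_of_eq hr) hlow hup

/-- **The same at a MULTIPLICATIVE prime `p` (the X11b situation, `p ∥ N`), with Cha's "non-CM" and
"`p² ∤ N`" DISCHARGED**: a CM curve has no multiplicative prime (`not_mult_of_hasCM`, Silverman
ATAEC II.6.4), and the level `N` of the Heegner datum is the conductor (Carayol, `hC`) whose exponent
at a multiplicative prime is `1` (`not_sq_dvd_level_of_isHeegnerPoint`, x11b gen 9). Remaining per
pair: the Heegner field (`p ∤ d_K`), the index certificate at one `q ∣ N`, `#Sel^(p) = p^(1+2k)`,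
`ord_p #Ш_an = 2k`. FLAG `Miller11-Thm54-Cha-case`. Per pair; not a class theorem.
[cite: Miller2011LMS, Thm. 5.4, Thm. 5.2 and Def. 1.1] [cite: Carayol1986, Thm. (A)]
[cite: SilvermanATAEC1994, Thm. II.6.4 (PDF p. 148) and IV.10.2(c)] [cite: SilvermanAEC2009, Thm. X.4.2(a)] -/
theorem bsdp_of_mult_of_millerJetchev_of_card_selmer
    (hGZK : rank_eq_analyticRank_of_analyticRank_le_one)
    (hMJ : thm54_cha_padicValNat_shaOrder_add_tamagawa_le)
    (hC : ∀ (M : ℕ) [NeZero M], IsNewformOf.level_eq_conductorNorm (N := M))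
    (hmult : Mult W p) (hr : W.analyticRank = 1) (hp2 : p ≠ 2) (hirr : Irr W p)
    {N : ℕ} [NeZero N] {K : Type} [Field K] [NumberField K] (hK : IsImaginaryQuadratic K)
    (hH : SatisfiesHeegnerHypothesis N K) {P : (W.baseChange K).toAffine.Point}
    (hP : IsHeegnerPoint N W K P) (hnt : ¬ IsOfFinAddOrder P)
    (hpD : ¬ (p : ℤ) ∣ NumberField.discr K)
    (q : ℕ) [Fact q.Prime] (hqN : q ∣ N) {k : ℕ}
    (hI : padicValNat p (AddSubgroup.zmultiples P).index ≤
      k + padicValNat p ((W.baseChange ℚ_[q]).localTamagawaNumber ℤ_[q]))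
    (hcard : Nat.card (W.selmerGroup (p : ℤ)) = p ^ (1 + 2 * k))
    {s : ℚ} (hs : shaAn W = (s : ℂ)) (hv : padicValRat p s = 2 * k) : BSDp W p :=
  bsdp_of_millerJetchev_of_card_selmer W p hGZK hMJ (fun hCM ↦ not_mult_of_hasCM W hCM p hmult) hr hp2
    hirr hK hH hP hnt hpD (not_sq_dvd_level_of_isHeegnerPoint W p hC hmult hP) q hqN hI hcard hs hv

end ClassFree

/-! ### §2. The `p = 3` rows: the (T2′) LB3 classes (`#Sel₃ = 27`, `#Ш_an = 9`, `ord₃ I_K = 2`, `3 ∣ c_q`) -/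

section Three

variable (W : WeierstrassCurve ℚ) [W.IsElliptic] [W.IsGloballyMinimal]

/-- **X11 at `p = 3`, rank one (`IsX11Three`: `3 ∥ N`, `E[3]` irreducible, `r_an = 1`) — the (T2′)
LB3 shape: `#Sel^(3)(E/ℚ) = 27`, `ord_3 #Ш(E)_an = 2`, a Heegner field of record `K` (`3 ∤ d_K`) with
Heegner point `y_K` of infinite order and `ord_3 [E(K) : ℤ y_K] ≤ 2`, and ONE prime `q ∣ N` with
`3 ∣ c_q(E)` (`1 ≤ ord_3 c_q`) ⇒ `BSD(E,3)`**, from PUBLISHED theorems (Miller 2011 Thm. 5.4 in Cha's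
case, FLAG `Miller11-Thm54-Cha-case`; GZK; Carayol for the level) and those certificates — the index
certificate is `ord_3 I_K ≤ 1 + ord_3 c_q` with `k = 1`. EVIDENCE pointer (lane data, nothing booked
here): the five (T2′) classes `191424ce1, 318828a1, 368358k1, 463488bg1, 498525ca1` of the x11b gen-9 /
rmap-3 g5 "no upper half" list have this shape at their Heegner fields of record ("every Heegner
field of record has `ord₃ I_K = 2`"; `3 ∣ ∏c_ℓ`; `#Sel₃ = 27` EXACT in hand; `#Ш_an = 9`). Per pair;
X11 ∧ `r = 1` ∧ `p = 3` stays CONSTRUCTION-SHAPED (R6.2); label unchanged.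
[cite: Miller2011LMS, Thm. 5.4, Thm. 5.2 (arXiv:1010.2431 p. 11) and Def. 1.1] [cite: Jetchev2008, Cor. 1.5, Rem. 6.2]
[cite: Carayol1986, Thm. (A)] [cite: SilvermanAEC2009, Thm. X.4.2(a)] -/
theorem IsX11Three.bsdp_of_millerJetchev_of_card_selmerThree_eq
    (hGZK : rank_eq_analyticRank_of_analyticRank_le_one)
    (hMJ : thm54_cha_padicValNat_shaOrder_add_tamagawa_le)
    (hC : ∀ (M : ℕ) [NeZero M], IsNewformOf.level_eq_conductorNorm (N := M))
    (hX : IsX11Three W)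
    {N : ℕ} [NeZero N] {K : Type} [Field K] [NumberField K] (hK : IsImaginaryQuadratic K)
    (hH : SatisfiesHeegnerHypothesis N K) {P : (W.baseChange K).toAffine.Point}
    (hP : IsHeegnerPoint N W K P) (hnt : ¬ IsOfFinAddOrder P)
    (hpD : ¬ (3 : ℤ) ∣ NumberField.discr K)
    -- the certificates
    (q : ℕ) [Fact q.Prime] (hqN : q ∣ N)
    (hcq : 1 ≤ padicValNat 3 ((W.baseChange ℚ_[q]).localTamagawaNumber ℤ_[q]))
    (hI : padicValNat 3 (AddSubgroup.zmultiples P).index ≤ 2)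
    (hcard : Nat.card (W.selmerGroup (3 : ℤ)) = 27)
    {s : ℚ} (hs : shaAn W = (s : ℂ)) (hv : padicValRat 3 s = 2) : BSDp W 3 :=
  haveI : Fact (Nat.Prime 3) := ⟨by norm_num⟩
  bsdp_of_mult_of_millerJetchev_of_card_selmer W 3 hGZK hMJ hC hX.mult hX.rank (by norm_num) hX.irr hK
    hH hP hnt (by exact_mod_cast hpD) q hqN (k := 1) (by omega)
    (by rw [show ((3 : ℕ) : ℤ) = 3 by norm_num, hcard]; norm_num) hs (by rw [hv]; norm_num)

/-- **The same in the vocabulary of `ClassX11b W 3`** (`r_an = 1 ∧ 3 ≠ 2 ∧ mult(3) ∧ irr(3)`,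
`Partition/Rows.lean`), the class predicate of route p2's records. Per pair; nothing booked; FLAG
`Miller11-Thm54-Cha-case`. [cite: Miller2011LMS, Thm. 5.4, Thm. 5.2 and Def. 1.1] [cite: Carayol1986, Thm. (A)] -/
theorem ClassX11b.bsdp_three_of_millerJetchev_of_card_selmerThree_eq
    (hGZK : rank_eq_analyticRank_of_analyticRank_le_one)
    (hMJ : thm54_cha_padicValNat_shaOrder_add_tamagawa_le)
    (hC : ∀ (M : ℕ) [NeZero M], IsNewformOf.level_eq_conductorNorm (N := M))
    [Fact (Nat.Prime 3)] (hX : ClassX11b W 3)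
    {N : ℕ} [NeZero N] {K : Type} [Field K] [NumberField K] (hK : IsImaginaryQuadratic K)
    (hH : SatisfiesHeegnerHypothesis N K) {P : (W.baseChange K).toAffine.Point}
    (hP : IsHeegnerPoint N W K P) (hnt : ¬ IsOfFinAddOrder P)
    (hpD : ¬ (3 : ℤ) ∣ NumberField.discr K)
    (q : ℕ) [Fact q.Prime] (hqN : q ∣ N)
    (hcq : 1 ≤ padicValNat 3 ((W.baseChange ℚ_[q]).localTamagawaNumber ℤ_[q]))
    (hI : padicValNat 3 (AddSubgroup.zmultiples P).index ≤ 2)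
    (hcard : Nat.card (W.selmerGroup (3 : ℤ)) = 27)
    {s : ℚ} (hs : shaAn W = (s : ℂ)) (hv : padicValRat 3 s = 2) : BSDp W 3 :=
  IsX11Three.bsdp_of_millerJetchev_of_card_selmerThree_eq W hGZK hMJ hC ⟨hX.2.2.1, hX.2.2.2, hX.1⟩ hK
    hH hP hnt hpD q hqN hcq hI hcard hs hv

/-- **General `p = 3` form** (any `k`): `IsX11Three W`, a Heegner field of record (`3 ∤ d_K`), Heegner
point of infinite order with `ord_3 [E(K) : ℤ y_K] ≤ k + ord_3 c_q(E)` at ONE prime `q ∣ N`,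
`#Sel^(3)(E/ℚ) = 3^(1+2k)`, `ord_3 #Ш(E)_an = 2k` ⇒ `BSD(E,3)` (`k = 0`: the Miller–Jetchev certificate
case with `#Sel₃ = 3`; `k = 1`: the LB3 rows above). FLAG `Miller11-Thm54-Cha-case`. Per pair; label
unchanged. [cite: Miller2011LMS, Thm. 5.4, Thm. 5.2 and Def. 1.1] [cite: Carayol1986, Thm. (A)]
[cite: SilvermanAEC2009, Thm. X.4.2(a)] -/
theorem IsX11Three.bsdp_of_millerJetchev_of_card_selmerThree
    (hGZK : rank_eq_analyticRank_of_analyticRank_le_one)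
    (hMJ : thm54_cha_padicValNat_shaOrder_add_tamagawa_le)
    (hC : ∀ (M : ℕ) [NeZero M], IsNewformOf.level_eq_conductorNorm (N := M))
    (hX : IsX11Three W)
    {N : ℕ} [NeZero N] {K : Type} [Field K] [NumberField K] (hK : IsImaginaryQuadratic K)
    (hH : SatisfiesHeegnerHypothesis N K) {P : (W.baseChange K).toAffine.Point}
    (hP : IsHeegnerPoint N W K P) (hnt : ¬ IsOfFinAddOrder P)
    (hpD : ¬ (3 : ℤ) ∣ NumberField.discr K)
    (q : ℕ) [Fact q.Prime] (hqN : q ∣ N) {k : ℕ}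
    (hI : padicValNat 3 (AddSubgroup.zmultiples P).index ≤
      k + padicValNat 3 ((W.baseChange ℚ_[q]).localTamagawaNumber ℤ_[q]))
    (hcard : Nat.card (W.selmerGroup (3 : ℤ)) = 3 ^ (1 + 2 * k))
    {s : ℚ} (hs : shaAn W = (s : ℂ)) (hv : padicValRat 3 s = 2 * k) : BSDp W 3 :=
  haveI : Fact (Nat.Prime 3) := ⟨by norm_num⟩
  bsdp_of_mult_of_millerJetchev_of_card_selmer W 3 hGZK hMJ hC hX.mult hX.rank (by norm_num) hX.irr hK
    hH hP hnt (by exact_mod_cast hpD) q hqN (k := k) hI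
    (by rw [show ((3 : ℕ) : ℤ) = 3 by norm_num]; exact hcard) hs hv

end Three

/-! ### §3. The same rows in the SECOND currency: the Tamagawa-sharpened bound AT THE DATUM as an
explicit, labelled hypothesis (no named fact consumed) — appended 2026-08-21 (seat p5) -/

section DatumShape

variable (W : WeierstrassCurve ℚ) [W.IsElliptic] (p : ℕ) [Fact p.Prime]

/-- **Rank one, odd `p`, `E[p]` irreducible: `BSD(E,p)` from the Tamagawa-sharpened index bound
SUPPLIED AT THE DATUM as a hypothesis** (`hJ`: `ord_p #Ш(E/ℚ) + 2·ord_p c_q(E) ≤ 2·ord_p [E(K) : ℤ P]`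
at ONE prime `q` — the SHAPE of Jetchev 2008 Cor. 1.5 / Miller 2011 Thm. 5.4 read over `ℚ` at the pair's
Heegner datum; at `p ∣ N` this is the lane's reading `JET@p|N`, NOT a theorem of the tree: Jetchev's
printed Hypothesis (∗) is "`p ∤ 2N`"; the only printed statement allowing `p ∥ N` is Miller's Thm. 5.4
in Cha's case, consumed WITH ITS FLAG in §1–§2) **+ the index certificate `ord_p [E(K):ℤP] ≤ k + ord_p c_q`
+ the exact `p`-descent count `#Sel^(p)(E/ℚ) = p^(1+2k)` + `ord_p #Ш(E)_an = 2k`.** This is the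
flag-free currency of `bsdp_of_millerJetchev_of_card_selmer`: whoever supplies `hJ` (a future
Jetchev-at-`p ∣ N` theorem built on `X11b/JetchevConnectedKummerCore.lean`, or a booking modulo the
reading flag) gets `BSD(E,p)` with no further input than GZK. `P` is any point of `E(K)` here (in every
use: the Heegner point of record). Per pair; nothing booked; not a class theorem.
[claim: Jetchev2008, status: under-review]
[cite: Jetchev2008, Hypothesis (*), Cor. 1.5 (p. 3) (shape only; nothing asserted)]
[cite: Miller2011LMS, Thm. 5.4 (arXiv:1010.2431 p. 11) and Def. 1.1] [cite: SilvermanAEC2009, Thm. X.4.2(a)] -/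
theorem bsdp_of_jetchevShapeAt_of_card_selmer
    (hGZK : rank_eq_analyticRank_of_analyticRank_le_one)
    (hr : W.analyticRank = 1) (hirr : Irr W p)
    {K : Type} [Field K] [NumberField K] (P : (W.baseChange K).toAffine.Point)
    (q : ℕ) [Fact q.Prime] {k : ℕ}
    -- the Tamagawa-sharpened bound AT THE DATUM (shape of Jetchev Cor. 1.5 / Miller Thm. 5.4; at
    -- `p ∣ N` a LABELLED OPEN reading, supplied by the caller)
    (hJ : padicValNat p W.shaOrder +
        2 * padicValNat p ((W.baseChange ℚ_[q]).localTamagawaNumber ℤ_[q]) ≤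
      2 * padicValNat p (AddSubgroup.zmultiples P).index)
    -- the certificates
    (hI : padicValNat p (AddSubgroup.zmultiples P).index ≤
      k + padicValNat p ((W.baseChange ℚ_[q]).localTamagawaNumber ℤ_[q]))
    (hcard : Nat.card (W.selmerGroup (p : ℤ)) = p ^ (1 + 2 * k))
    {s : ℚ} (hs : shaAn W = (s : ℂ)) (hv : padicValRat p s = 2 * k) : BSDp W p := by
  obtain ⟨hrk, hfin⟩ := hGZK W (le_of_eq hr)
  -- LOWER certificate `p^(2k) ∣ #Ш(E/ℚ)` from the Selmer count (no rational `p`-torsion: Mazur)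
  have hdvd : p ^ (2 * k) ∣ W.shaOrder :=
    pow_dvd_shaOrder_of_card_selmerGroup W p (j := 2 * k) (by rw [hrk, hr]; exact hcard)
      ((natCard_torsionBy_point_eq_of_subsingleton W _ _ _).trans
        (natCard_torsionBy_eq_one_of_hasIrreducibleModPGaloisRep W p hirr))
  have hlow : MissingLowerBoundAt W p :=
    missingLowerBoundAt_of_pow_dvd W p hfin hs (j := 2 * k) (by rw [hv]; push_cast; exact le_rfl) hdvd
  -- UPPER half: `ord_p #Ш ≤ 2k` by arithmetic from `hJ` and `hI`
  have hup' : padicValNat p W.shaOrder ≤ 2 * k := by omega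
  have hup : MissingUpperBoundAt W p := ⟨s, hs, by rw [hv]; exact_mod_cast hup'⟩
  exact bsdp_of_halves hGZK W p (le_of_eq hr) hlow hup

/-- **The (T2′) LB3 rows at `p = 3` in the flag-free currency**: `IsX11Three W`, the Heegner point of
record `P = y_K`, ONE prime `q ∣ N` with `1 ≤ ord_3 c_q(E)`, the datum-level Tamagawa-sharpened bound
`hJ` (LABELLED OPEN reading `JET@3|N` — see `bsdp_of_jetchevShapeAt_of_card_selmer`), `ord_3 [E(K):ℤP] ≤ 2`,
`#Sel^(3)(E/ℚ) = 27`, `ord_3 #Ш(E)_an = 2` ⇒ `BSD(E,3)`. Same five classes as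
`IsX11Three.bsdp_of_millerJetchev_of_card_selmerThree_eq`, for a booking phrased "modulo `JET@3|N`"
rather than "via Miller Thm. 5.4 (Cha case) with flag". Per pair; nothing booked; label unchanged.
[claim: Jetchev2008, status: under-review]
[cite: Jetchev2008, Hypothesis (*), Cor. 1.5 (p. 3) (shape only; nothing asserted)] [cite: Miller2011LMS, Def. 1.1] -/
theorem IsX11Three.bsdp_of_jetchevShapeAt_of_card_selmerThree_eq
    (hGZK : rank_eq_analyticRank_of_analyticRank_le_one) (hX : IsX11Three W)
    {K : Type} [Field K] [NumberField K] (P : (W.baseChange K).toAffine.Point)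
    (q : ℕ) [Fact q.Prime]
    (hJ : padicValNat 3 W.shaOrder +
        2 * padicValNat 3 ((W.baseChange ℚ_[q]).localTamagawaNumber ℤ_[q]) ≤
      2 * padicValNat 3 (AddSubgroup.zmultiples P).index)
    (hcq : 1 ≤ padicValNat 3 ((W.baseChange ℚ_[q]).localTamagawaNumber ℤ_[q]))
    (hI : padicValNat 3 (AddSubgroup.zmultiples P).index ≤ 2)
    (hcard : Nat.card (W.selmerGroup (3 : ℤ)) = 27)
    {s : ℚ} (hs : shaAn W = (s : ℂ)) (hv : padicValRat 3 s = 2) : BSDp W 3 :=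
  haveI : Fact (Nat.Prime 3) := ⟨by norm_num⟩
  bsdp_of_jetchevShapeAt_of_card_selmer W 3 hGZK hX.rank hX.irr P q (k := 1) hJ (by omega)
    (by rw [show ((3 : ℕ) : ℤ) = 3 by norm_num, hcard]; norm_num) hs (by rw [hv]; norm_num)

end DatumShape

end Summit.BirchSwinnertonDyer.Rank1Residual.X11b.Three

end
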